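import Summits.AnomalousDissipation.AnomalousDissipation.Theorems.SolenoidalFractalHomogenisationLagrangianStepSidebandXSlowDefs
import Literature.Analysis.FluidPDE.PassiveVectorTensorModalAdjointCoeff
import HarnessLib

/-!
# K1L_D `LagrangianRenormalisationStepDesign` (stmt-AnomalousDissipation-27980), `stub_D1_V0R` (D27-1; V0 = clause (ii) of
# `WCrossing.D1ExactFamily`), brick T7: THE AUGMENTED EFFECTIVE SLOW GENERATOR on `ℂ³` (shared definition; reviewed;
# `--kind definition --supports stmt-AnomalousDissipation-27980 --as helper`)

Summits-side DEFINITIONS file of route `SolenoidalFractalHomogenisation` (prover seat `ad-k1l-cellLawV-w1` g7).  The averaged generator `Ḡ` consumed by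
`…SidebandXSlowAveraging.norm_modeRep_sub_exp_le` must be an `ℝ`-linear operator on ALL of `ℂ³`, coercive there, and agree with the modal generator
`4π² P_ℓ T_{𝔹'ᵀ}(ℓ)` on `ℓ`-transversal vectors.  The modal generator alone is not coercive (it kills the longitudinal line `ℂ ℓ̂`); the standard
augmentation adds `r₁ (1 − P_ℓ)` (idle on transversal states, as the `γ₁` augmentation of `Sideband.gen`):
* `effGenC 𝔹' ℓ r₁ := (modalAdjGen 𝔹'ᵀ ℓ ∘ P_ℓ)↾ℝ + r₁ • (1 − P_ℓ)↾ℝ : ℂ³ →L[ℝ] ℂ³` (`modalAdjGen 𝔸 k = 4π² P_k ∘ T_𝔸(k)`, Literature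
  `PassiveVectorTensorModalAdjointCoeff`).
For `𝔹' = (1/n²)•(𝔸 + (1/ν)•psiStar ν ((1/ν)•𝔸))` this is the slow generator of the effective cell tensor of clause (V) (bricks T7a/T7b in
`…SidebandXEffGen`).  Definition + unfolding lemma only; no theorem of substance, no named fact, no sorry.  NOT a proof of anything; rung F-D1.A0
infrastructure.  AD is not proved.
-/

set_option linter.dupNamespace false

noncomputable section

namespace Summit.AnomalousDissipation.AnomalousDissipation.Theorems.SolenoidalFractalHomogenisation.LagrangianStep.Sideband

open Set MeasureTheory Complex UnitAddTorus
open scoped InnerProductSpace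
open Literature.Analysis Literature.Analysis.FunctionSpaces Literature.Analysis.FunctionSpaces.Torus
open Literature.Analysis.FluidPDE Literature.Analysis.FluidPDE.Torus Literature.Analysis.FluidPDE.LatticeShear

/-- **The augmented effective slow generator** `effGenC 𝔹' ℓ r₁ = (4π² P_ℓ T_{𝔹'ᵀ}(ℓ) P_ℓ)↾ℝ + r₁ • (1 − P_ℓ)↾ℝ` on `ℂ³`.
[cite: MajdaKramer1999, §2.2.1.3 (55) (effective diffusivity)] [cite: SandersVerhulstMurdock2007, Theorem 2.8.1 (averaged equation)] -/
def effGenC (𝔹' : Torus.Visc4 (Fin 3)) (ℓ : Fin 3 → ℤ) (r₁ : ℝ) : EuclideanSpace ℂ (Fin 3) →L[ℝ] EuclideanSpace ℂ (Fin 3) :=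
  ((Torus.modalAdjGen (Torus.majorTranspose 𝔹') ℓ).comp (transversalProj ℓ)).restrictScalars ℝ +
    r₁ • (ContinuousLinearMap.id ℂ (EuclideanSpace ℂ (Fin 3)) - transversalProj ℓ).restrictScalars ℝ

/-- Unfolding `effGenC` on a vector. [cite: MajdaKramer1999, §2.2.1.3 (55)] -/
theorem effGenC_apply (𝔹' : Torus.Visc4 (Fin 3)) (ℓ : Fin 3 → ℤ) (r₁ : ℝ) (v : EuclideanSpace ℂ (Fin 3)) :
    effGenC 𝔹' ℓ r₁ v = Torus.modalAdjGen (Torus.majorTranspose 𝔹') ℓ (transversalProj ℓ v) + r₁ • (v - transversalProj ℓ v) := by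
  simp only [effGenC, add_apply, ContinuousLinearMap.coe_restrictScalars', ContinuousLinearMap.comp_apply,
    FunLike.coe_smul, Pi.smul_apply, sub_apply, ContinuousLinearMap.id_apply]

end Summit.AnomalousDissipation.AnomalousDissipation.Theorems.SolenoidalFractalHomogenisation.LagrangianStep.Sideband

end
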